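import Literature.AlgebraicGeometry.Motives.OpenSubfunctorCover
import HarnessLib

/-!
# The charts of an open-condition cover are an open cover of the representing scheme

Topic: `Literature/AlgebraicGeometry/Motives`. Companion to `OpenSubfunctorCover`: under the hypotheses of
`isRepresentable_of_openCondition_cover` (a Zariski sheaf `F` on `Sch`, injective maps
`f i : h_{X i} → F` with open-condition images, covering the field-valued points) the representing scheme
`Y` may be CHOSEN together with open immersions `g i : X i → Y` which cover `Y` and induce the `f i`
(Görtz–Wedhorn Thm. 8.9: «… F is representable by the gluing of the `X i` along the open subfunctors»; Mathlib
`Scheme.LocalRepresentability.representableBy` / `glueData`).  This is the form needed to transfer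
LOCAL properties of the charts (locally of finite type, smooth, …) and quasi-compactness (finitely many
charts) to the representing scheme.

* `exists_iso_openCover_of_openCondition_cover` — `∃ Y, (e : yoneda.obj Y ≅ F), (g i : X i ⟶ Y)` open
  immersions, jointly surjective, with `yoneda.map (g i) ≫ e.hom = f i` (so `Functor.representableByEquiv.symm e`
  is a `RepresentableBy` whose `homEquiv` sends `a ≫ g i` to `(f i)(a)`).
* `exists_iso_openCover_of_openSubfunctor_cover` — the same for representable subfunctors `P i ⊆ F`.

## Sources

* U. Görtz, T. Wedhorn, *Algebraic Geometry I* (2nd ed. 2020), Thm. 8.9 (p. 212) and its proof.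
* The Stacks Project, Tag 01JJ.
-/

namespace Literature.AlgebraicGeometry.Motives

universe u

open CategoryTheory CategoryTheory.Limits Opposite _root_.AlgebraicGeometry
  _root_.AlgebraicGeometry.Scheme

/-- **The charts glue to the representing scheme** (Görtz–Wedhorn Thm. 8.9, proof): under the hypotheses of
`isRepresentable_of_openCondition_cover` there are a scheme `Y` with `e : h_Y ≅ F` and OPEN IMMERSIONS
`g i : X i → Y` covering `Y` such that `h_{g i} ≫ e = f i` (the chart maps are the given `f i`).
[cite: GortzWedhorn2020, Thm. 8.9 (p. 212)] -/
theorem exists_iso_openCover_of_openCondition_cover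
    (F : Sheaf Scheme.zariskiTopology.{u} (Type u))
    {ι : Type u} {X : ι → Scheme.{u}} (f : ∀ i, yoneda.obj (X i) ⟶ F.1)
    (hinj : ∀ (i : ι) (T : Scheme.{u}), Function.Injective ((f i).app (op T)))
    (U : ∀ (i : ι) {T : Scheme.{u}}, F.1.obj (op T) → T.Opens)
    (hU : ∀ (i : ι) {T T' : Scheme.{u}} (x : F.1.obj (op T)) (h : T' ⟶ T),
      F.1.map h.op x ∈ Set.range ((f i).app (op T')) ↔ Set.range h ⊆ (U i x : Set T))
    (hcover : ∀ (K : Type u) [Field K] (x : F.1.obj (op (Spec (CommRingCat.of K)))),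
      ∃ i, x ∈ Set.range ((f i).app (op (Spec (CommRingCat.of K))))) :
    ∃ (Y : Scheme.{u}) (e : yoneda.obj Y ≅ F.1) (g : ∀ i, X i ⟶ Y),
      (∀ i, IsOpenImmersion (g i)) ∧ (∀ y : Y, ∃ i, y ∈ Set.range (g i)) ∧
      ∀ i, yoneda.map (g i) ≫ e.hom = f i := by
  have hf : ∀ i, IsOpenImmersion.presheaf (f i) := fun i =>
    isOpenImmersion_presheaf_of_openCondition (f i) (hinj i) (U i) (hU i)
  haveI := isLocallySurjective_sigmaDesc_of_openCondition f U hU hcover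
  refine ⟨(LocalRepresentability.glueData hf).glued,
    (sheafToPresheaf _ _).mapIso (LocalRepresentability.yonedaIsoSheaf hf),
    fun i => LocalRepresentability.toGlued hf i, fun i => inferInstance, fun y => ?_, fun i => ?_⟩
  · obtain ⟨i, z, hz⟩ := (LocalRepresentability.glueData hf).openCover.exists_eq y
    exact ⟨i, z, hz⟩
  · exact LocalRepresentability.yoneda_toGlued_yonedaGluedToSheaf hf i

/-- **Subfunctor form**: under the hypotheses of `isRepresentable_of_openSubfunctor_cover` (representable
subfunctors `P i ⊆ F` cut out by open conditions, covering the field-valued points), the representing objects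
`(P i).reprX` of the charts are an open cover of a scheme `Y` with `h_Y ≅ F`, compatibly with
`(P i).reprW ≫ (P i).ι`. [cite: GortzWedhorn2020, Thm. 8.9 (p. 212)] -/
theorem exists_iso_openCover_of_openSubfunctor_cover (F : Sheaf Scheme.zariskiTopology.{u} (Type u))
    {ι : Type u} (P : ι → Subfunctor F.1) (hrep : ∀ i, (P i).toFunctor.IsRepresentable)
    (U : ∀ (i : ι) {T : Scheme.{u}}, F.1.obj (op T) → T.Opens)
    (hU : ∀ (i : ι) {T T' : Scheme.{u}} (x : F.1.obj (op T)) (h : T' ⟶ T),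
      F.1.map h.op x ∈ (P i).obj (op T') ↔ Set.range h ⊆ (U i x : Set T))
    (hcover : ∀ (K : Type u) [Field K] (x : F.1.obj (op (Spec (CommRingCat.of K)))),
      ∃ i, x ∈ (P i).obj (op (Spec (CommRingCat.of K)))) :
    ∃ (Y : Scheme.{u}) (e : yoneda.obj Y ≅ F.1) (g : ∀ i, (P i).toFunctor.reprX ⟶ Y),
      (∀ i, IsOpenImmersion (g i)) ∧ (∀ y : Y, ∃ i, y ∈ Set.range (g i)) ∧
      ∀ i, yoneda.map (g i) ≫ e.hom = (P i).toFunctor.reprW.hom ≫ (P i).ι := by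
  let f : ∀ i, yoneda.obj (P i).toFunctor.reprX ⟶ F.1 := fun i => (P i).toFunctor.reprW.hom ≫ (P i).ι
  have hrange : ∀ (i : ι) (T : Scheme.{u}),
      Set.range ((f i).app (op T)) = (P i).obj (op T) := by
    intro i T
    ext y
    constructor
    · rintro ⟨g, rfl⟩
      exact ((P i).toFunctor.reprW.hom.app (op T) g).2
    · intro hy
      refine ⟨(P i).toFunctor.reprW.inv.app (op T) ⟨y, hy⟩, ?_⟩
      change (P i).ι.app (op T) (((P i).toFunctor.reprW.inv ≫ (P i).toFunctor.reprW.hom).app (op T)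
        ⟨y, hy⟩) = y
      rw [Iso.inv_hom_id]
      rfl
  exact exists_iso_openCover_of_openCondition_cover F f
    (fun i T => Subtype.val_injective.comp ((P i).toFunctor.reprW.app (op T)).toEquiv.injective) U
    (fun i T T' x h => by rw [hrange, ← hU i x h]) fun K _ x => by
      obtain ⟨i, hi⟩ := hcover K x
      exact ⟨i, by rw [hrange]; exact hi⟩

end Literature.AlgebraicGeometry.Motives
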